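import Literature.NumberTheory.EllipticCurves.UnrIntegersSqrtNegOne
import Mathlib.NumberTheory.GaussSum
import Mathlib.RingTheory.Polynomial.Cyclotomic.Roots
import Mathlib.Data.Nat.Squarefree
import HarnessLib

/-!
# Square roots of squarefree integers prime to `p` lie in `R₀ = unrIntegers p` (odd `p`), via Gauss sums

Topic `NumberTheory/EllipticCurves` (the receptacle `R₀ = unrIntegers p ⊂ ℂ_p` of the tree's BDP anticyclotomic
`p`-adic `L`-functions, `BDPAnticyclotomicPAdicLFunction.lean` §2; sibling of `UnrIntegersSqrtNegOne.lean`).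
Theorem-only file (no definition, no named fact). Cells `bsd-eis` (seat `bsd-eis-cgshw` g15) / `bsd-stepL`
(plan g32 RULING 17 (C)(β): stub `stub_sqrt_mem_unrIntegers` of line `lzz` of crux 19493 `ValueContinuityAtThree`).

For an odd prime `p` and a squarefree natural number `m` with `p ∤ m`, there is `x ∈ R₀` with `x² = m`
(`exists_sq_eq_natCast_mem_unrIntegers_of_squarefree`). Printed road: `R₀ ⊇ ℤ[ζ_n : p ∤ n]` (Castella 2018 §3;
tree `mem_unrIntegers_of_pow_eq_one`), and
* for an odd prime `q ≠ p` the quadratic GAUSS SUM `g = Σ_{a mod q} (a/q) ζ_q^a ∈ ℤ[ζ_q]` has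
  `g² = (−1/q)·q` (Mathlib `gaussSum_sq`; Ireland–Rosen Prop. 6.3.2), and `√−1 ∈ R₀` for odd `p`
  (`exists_sq_eq_neg_one_mem_unrIntegers`, `ζ₈²`), so `√q = g` or `√−1·g` lies in `R₀`
  (`exists_sq_eq_prime_mem_unrIntegers`);
* `√2 = ζ₈ + ζ₈⁻¹ ∈ ℤ[ζ₈] ⊂ R₀` (`exists_sq_eq_two_mem_unrIntegers`);
* a squarefree `m` is the product of its prime factors (Mathlib `Nat.prod_primeFactors_of_squarefree`).
The primitive `q`-th root of unity in `ℂ_p` is a root of the cyclotomic polynomial (`IsAlgClosed.exists_root`,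
`Polynomial.isRoot_cyclotomic_iff`). HONEST FRAMING: an elementary lemma about the receptacle; proves nothing about
any `L`-function, crux or case of BSD. USE (bsd-stepL crux 19493, line lzz): with `m = |d_K|` (odd fundamental
discriminant, `3 ∤ d_K`) the bsd-eis rescale's unit `±ι'⁻¹(2)·ι'⁻¹(c_M)⁻²·ι'⁻¹(√|d_K|)⁻¹` lies in `R₀ˣ`.

References: [IrelandRosen1990] K. Ireland, M. Rosen, *A Classical Introduction to Modern Number Theory*, 2nd ed.,
§6.2 (`(ζ₈ + ζ₈⁻¹)² = 2`) and Prop. 6.3.2 (`g² = (−1)^{(p−1)/2} p`); [Castella2018] Camb. J. Math. 6 (2018) §3 p. 9 (the ring `R₀`).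
-/

noncomputable section

namespace Literature.NumberTheory.EllipticCurves

open Polynomial

variable {p : ℕ} [Fact p.Prime]

/-- **A primitive `q`-th root of unity in `ℂ_p`** (`q ≥ 1`): a root of the `q`-th cyclotomic polynomial, which
has one since `ℂ_p` is algebraically closed of characteristic `0` (`Polynomial.isRoot_cyclotomic_iff`). [folklore] -/
private theorem exists_isPrimitiveRoot_padicComplex {q : ℕ} (hq : 0 < q) : ∃ ζ : ℂ_[p], IsPrimitiveRoot ζ q := by
  haveI : NeZero (q : ℂ_[p]) := ⟨by exact_mod_cast hq.ne'⟩
  have hdeg : (cyclotomic q ℂ_[p]).degree ≠ 0 := by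
    rw [degree_cyclotomic]
    exact_mod_cast (Nat.totient_pos.mpr hq).ne'
  obtain ⟨ζ, hζ⟩ := IsAlgClosed.exists_root (cyclotomic q ℂ_[p]) hdeg
  exact ⟨ζ, isRoot_cyclotomic_iff.mp hζ⟩

/-- **`√q ∈ R₀` for an odd prime `q ≠ p`, `p` odd — by the quadratic GAUSS SUM.** With `ζ` a primitive
`q`-th root of unity in `ℂ_p`, `ψ_a = ζ^a` (a primitive additive character of `ℤ/q`) and `χ` the quadratic
character, `g = Σ χ(a)ψ(a) ∈ ℤ[ζ] ⊂ R₀` and `g² = χ(−1)·q` (Mathlib `gaussSum_sq`); `χ(−1) = ±1`, and in the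
case `−1` multiply by `√−1 ∈ R₀` (`exists_sq_eq_neg_one_mem_unrIntegers`).
[cite: IrelandRosen1990, Prop. 6.3.2 (the square of the quadratic Gauss sum)] [cite: Castella2018, §3 (p. 9) (roots of unity of order prime to p lie in R₀)] -/
theorem exists_sq_eq_prime_mem_unrIntegers (hp2 : p ≠ 2) {q : ℕ} (hq : q.Prime) (hq2 : q ≠ 2)
    (hqp : q ≠ p) : ∃ y ∈ unrIntegers p, y ^ 2 = (q : ℂ_[p]) := by
  classical
  haveI : Fact q.Prime := ⟨hq⟩
  have hpq : ¬ p ∣ q := fun h ↦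
    hqp (((Nat.prime_dvd_prime_iff_eq (Fact.out : p.Prime) hq).mp h).symm)
  obtain ⟨ζ, hζ⟩ := exists_isPrimitiveRoot_padicComplex (p := p) hq.pos
  have hζq : ζ ^ q = 1 := hζ.pow_eq_one
  -- the primitive additive character `a ↦ ζ^a` and the quadratic character with values in `ℂ_p`
  have hψ : (AddChar.zmodChar q hζq).IsPrimitive := AddChar.zmodChar_primitive_of_primitive_root q hζ
  set χ : MulChar (ZMod q) ℂ_[p] := (quadraticChar (ZMod q)).ringHomComp (Int.castRingHom ℂ_[p]) with hχ
  have hχ1 : χ ≠ 1 := by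
    rw [hχ, MulChar.ringHomComp_ne_one_iff Int.cast_injective]
    exact quadraticChar_ne_one (by rw [ZMod.ringChar_zmod_n]; exact hq2)
  have hχ2 : χ.IsQuadratic := (quadraticChar_isQuadratic (ZMod q)).comp _
  have hg : gaussSum χ (AddChar.zmodChar q hζq) ^ 2 = χ (-1) * (q : ℂ_[p]) := by
    rw [gaussSum_sq hχ1 hχ2 hψ, ZMod.card q]
  -- the Gauss sum lies in `R₀`
  have hgR : gaussSum χ (AddChar.zmodChar q hζq) ∈ unrIntegers p := by
    unfold gaussSum
    refine sum_mem fun a _ ↦ mul_mem ?_ ?_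
    · rcases hχ2 a with h | h | h <;> rw [h]
      · exact zero_mem _
      · exact one_mem _
      · exact neg_mem (one_mem _)
    · rw [AddChar.zmodChar_apply]
      exact pow_mem (mem_unrIntegers_of_pow_eq_one hq.pos hpq hζq) _
  -- `χ(−1) = ±1`
  have hχm1 : χ (-1) = 1 ∨ χ (-1) = -1 := by
    rcases hχ2 (-1) with h | h | h
    · exfalso
      have h1 : χ (-1) * χ (-1) = 1 := by rw [← map_mul, neg_one_mul, neg_neg, MulChar.map_one]
      rw [h, zero_mul] at h1
      exact zero_ne_one h1
    · exact Or.inl h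
    · exact Or.inr h
  rcases hχm1 with h1 | h1
  · exact ⟨gaussSum χ (AddChar.zmodChar q hζq), hgR, by rw [hg, h1, one_mul]⟩
  · obtain ⟨i, hiR, hi2⟩ := exists_sq_eq_neg_one_mem_unrIntegers (p := p) hp2
    refine ⟨i * gaussSum χ (AddChar.zmodChar q hζq), mul_mem hiR hgR, ?_⟩
    rw [mul_pow, hi2, hg, h1]
    ring

/-- **`√2 ∈ R₀` for odd `p`**: `√2 = ζ₈ + ζ₈⁻¹` with `ζ₈ ∈ R₀` a primitive 8-th root of unity
(`exists_pow_four_eq_neg_one_mem_unrIntegers`: `ζ⁴ = −1`, so `ζ² + ζ⁻² = 0` and `(ζ + ζ⁻¹)² = 2`).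
[cite: IrelandRosen1990, §6.2 (τ = ζ₈ + ζ₈⁻¹ has τ² = 2)] -/
theorem exists_sq_eq_two_mem_unrIntegers (hp2 : p ≠ 2) : ∃ y ∈ unrIntegers p, y ^ 2 = (2 : ℂ_[p]) := by
  obtain ⟨ζ, hζR, h4⟩ := exists_pow_four_eq_neg_one_mem_unrIntegers (p := p) hp2
  have hζ0 : ζ ≠ 0 := fun h ↦ by rw [h] at h4; norm_num at h4
  have h8 : ζ ^ 8 = 1 := by
    calc ζ ^ 8 = (ζ ^ 4) ^ 2 := by ring
      _ = 1 := by rw [h4]; norm_num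
  -- `ζ⁻¹ = ζ⁷ ∈ R₀`
  have hinv : ζ⁻¹ = ζ ^ 7 := by
    rw [eq_comm, ← mul_right_inj' hζ0, mul_inv_cancel₀ hζ0, ← pow_succ', h8]
  refine ⟨ζ + ζ⁻¹, add_mem hζR (by rw [hinv]; exact pow_mem hζR 7), ?_⟩
  have h2 : ζ ^ 2 * ζ ^ 2 = -1 := by rw [← pow_add]; exact h4
  have hsq : (ζ + ζ⁻¹) ^ 2 = ζ ^ 2 + 2 + (ζ ^ 2)⁻¹ := by
    field_simp
    ring
  rw [hsq]
  have hζ2 : ζ ^ 2 ≠ 0 := pow_ne_zero _ hζ0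
  have hinv2 : (ζ ^ 2)⁻¹ = -ζ ^ 2 := by
    rw [eq_comm, ← mul_right_inj' hζ2, mul_inv_cancel₀ hζ2, mul_neg, h2, neg_neg]
  rw [hinv2]
  ring

/-- **`√m ∈ R₀` for a squarefree `m` with `p ∤ 2m`** (i.e. `p` odd and `p ∤ m`): `m = ∏_{q ∣ m} q` over its
prime factors (`Nat.prod_primeFactors_of_squarefree`) and each `√q` lies in `R₀` (`exists_sq_eq_prime_mem_unrIntegers`,
`exists_sq_eq_two_mem_unrIntegers`). The shape is VERBATIM the stub `stub_sqrt_mem_unrIntegers` of line `lzz` of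
bsd-stepL's crux 19493 `ValueContinuityAtThree`. [cite: IrelandRosen1990, Prop. 6.3.2] [cite: Castella2018, §3 (p. 9)] -/
theorem exists_sq_eq_natCast_mem_unrIntegers_of_squarefree :
    ∀ (p : ℕ) [Fact p.Prime] (m : ℕ), Squarefree m → ¬ p ∣ 2 * m →
      ∃ x : ℂ_[p], x ∈ unrIntegers p ∧ x ^ 2 = (m : ℂ_[p]) := by
  intro p _ m hm hpm
  classical
  have hp : p.Prime := Fact.out
  have hp2 : p ≠ 2 := fun h ↦ hpm (h ▸ dvd_mul_right 2 m)
  have hpm' : ¬ p ∣ m := fun h ↦ hpm (dvd_mul_of_dvd_right h 2)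
  -- a square root in `R₀` of every prime factor of `m` (and `1` elsewhere)
  have key : ∀ q : ℕ, ∃ y : ℂ_[p], y ∈ unrIntegers p ∧ (q ∈ m.primeFactors → y ^ 2 = (q : ℂ_[p])) := by
    intro q
    by_cases hqm : q ∈ m.primeFactors
    · have hq : q.Prime := Nat.prime_of_mem_primeFactors hqm
      have hqp : q ≠ p := fun h ↦ hpm' (h ▸ Nat.dvd_of_mem_primeFactors hqm)
      by_cases hq2 : q = 2
      · subst hq2
        obtain ⟨y, hyR, hy⟩ := exists_sq_eq_two_mem_unrIntegers (p := p) hp2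
        exact ⟨y, hyR, fun _ ↦ by rw [hy]; norm_num⟩
      · obtain ⟨y, hyR, hy⟩ := exists_sq_eq_prime_mem_unrIntegers (p := p) hp2 hq hq2 hqp
        exact ⟨y, hyR, fun _ ↦ hy⟩
    · exact ⟨1, one_mem _, fun h ↦ absurd h hqm⟩
  choose y hyR hy2 using key
  refine ⟨∏ q ∈ m.primeFactors, y q, prod_mem fun q _ ↦ hyR q, ?_⟩
  rw [← Finset.prod_pow, Finset.prod_congr rfl fun q hq ↦ hy2 q hq, ← Nat.cast_prod,
    Nat.prod_primeFactors_of_squarefree hm]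

end Literature.NumberTheory.EllipticCurves

end
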